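import Mathlib
import Summits.ResolutionOfSingularities.ResolutionOfSingularities.Theorems.WeightedInvariantLocalWeightedDropNCResSettingHeadDropCurve

/-!
# `WeightedInvariant.LocalWeightedDrop`: NC-RESOLUTION SETTINGS for the TOT₂ line (S-SET), part 14 — GRAPH CURVES: definitions
# (the sub-regime «apex dimension ≤ 1, the point lies ON a permissible smooth curve» = S-E1-CURVE)

Crux item stmt-ResolutionOfSingularities-8899 `LocalWeightedDrop` (route `ResolutionOfSingularities/WeightedInvariant`), ENGINE skeleton v32,
residual `stub_spaceNCRankDrop`; TOT2-LINE v1.1/v1.2 (res-L1-w43-lead-1) inner dispatch at `o ≥ 2`; gap note `L/res-L1-w43-stub-1/E1-CURVE-GAP.md`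
(evidence on stmt-8899).  [OURS · L1 W4.3 · chain w43 · seat res-L1-w43-stub-1 gen 6 (S-SET author); DEFINITIONS + their immediate algebra;
the count game is the programme's own; nothing here is a statement of any manuscript; AI-produced, gate-checked, weaker than expert review.]

WHY.  At apex dimension `e(g) = 1` (`g = f·∏_{l∈O} x_l` of order `c`) a point ON a permissible smooth curve `C` (tangent to the directrix) is near
for ever under point blow-ups unless `C` is blown up; `C` may be blown up (S-SET `IsBPermissible` (P3)) only when it is an axis of LETTER-PRESERVING
coordinates, i.e. normal crossings with the boundary letters.  The sub-regime is run on an explicit GRAPH PRESENTATION of `C` over a coordinate axis,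
so that contact orders with the letter planes, the strict transform under the identity point move, and permissibility are all computable:

* `GraphCurve.onLetter i φ` — the one-variable series `φ` placed on the letter `x_i` (`PowerSeries.subst (X i) φ`);
* `GraphCurve.shear i φ` — the GRAPH SHEAR `x_i ↦ x_i`, `x_j ↦ x_j + φ_j(x_i)` (a legal coordinate change whose image of the `i`-axis is the curve
  `C = {x_j = φ_j(x_i)}` when `φ_j(0) = 0`);
* `GraphCurve.tangent i φ` — the tangent direction `(φ_j′(0))_j`, `1` at `i`;
* `GraphCurve.offDeg i E`, `GraphCurve.InOffIdeal i c G` — the degree of an exponent OFF the letter `i`, and «every monomial of `G` has off-`i` degree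
  `≥ c`» = `G ∈ (x_j : j ≠ i)^c` = the `i`-axis is permissible for `G` at order `c` (for `i = Fin.last` this is `AxisPolyhedron.InAxisIdeal`);
* `GraphCurve.tailDiv φ = φ / X` (for `φ(0) = 0`), `GraphCurve.stepSeries φ λ a = (φ(λ s) − a s)/s`, `GraphCurve.step i φ c′` — the graph of the
  STRICT TRANSFORM of `C` under the identity point move at the tangent answer `c′ = λ · tangent` (a graph over the NEW exceptional letter `0`);
* `GraphCurve.contactSq E i φ = Σ_{l ∈ E∖{i}} (ord φ_l)²` — the CONTACT POTENTIAL of `C` with the letter planes (`0` for letters containing `C`),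
  the measure of the loop of point moves (part 16).
Lemmas here: coefficient / constant-coefficient / substitution facts for `onLetter` and `shear`, legality of the shear (`isCountMove_shear`), the
tangent as the `i`-th column of the linear part, the `offDeg` arithmetic, `tailDiv`/`stepSeries` identities and orders.
-/

set_option linter.dupNamespace false -- mandated namespace of this single-conjunct summit

noncomputable section

namespace Summit.ResolutionOfSingularities.ResolutionOfSingularities.Theorems

namespace TameFourTupleDrop

namespace GraphCurve

open MvPowerSeries Literature.AlgebraicGeometry.Resolution

variable {k : Type} [Field k] {m : ℕ}

/-! ## One-variable series on a letter -/

/-- The one-variable series `φ` placed on the letter `x_i`: `φ(x_i) ∈ k⟦x₀,…,x_m⟧`. [OURS] -/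
def onLetter (i : Fin (m + 1)) (φ : PowerSeries k) : MvPowerSeries (Fin (m + 1)) k :=
  PowerSeries.subst (X i : MvPowerSeries (Fin (m + 1)) k) φ

/-- Coefficients of `φ(x_i)`: only pure powers of `x_i` occur. -/
theorem coeff_onLetter (i : Fin (m + 1)) (φ : PowerSeries k) (E : Fin (m + 1) →₀ ℕ) :
    coeff E (onLetter i φ) = if E = Finsupp.single i (E i) then PowerSeries.coeff (E i) φ else 0 := by
  classical
  unfold onLetter
  convert PowerSeries.coeff_subst_single i φ E

/-- The coefficient of `x_i^n` in `φ(x_i)` is the `n`-th coefficient of `φ`. -/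
theorem coeff_single_onLetter (i : Fin (m + 1)) (φ : PowerSeries k) (n : ℕ) :
    coeff (Finsupp.single i n) (onLetter i φ) = PowerSeries.coeff n φ := by
  rw [coeff_onLetter, Finsupp.single_eq_same, if_pos rfl]

/-- Constant coefficient of `φ(x_i)`. -/
theorem constantCoeff_onLetter (i : Fin (m + 1)) (φ : PowerSeries k) :
    constantCoeff (onLetter i φ) = PowerSeries.constantCoeff φ := by
  rw [← coeff_zero_eq_constantCoeff, ← Finsupp.single_zero i, coeff_single_onLetter, PowerSeries.coeff_zero_eq_constantCoeff]

/-- `0(x_i) = 0`. -/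
theorem onLetter_zero (i : Fin (m + 1)) : onLetter i (0 : PowerSeries k) = 0 := by
  ext E
  rw [coeff_onLetter, map_zero]
  split_ifs <;> simp

/-- `(-φ)(x_i) = -φ(x_i)`. -/
theorem onLetter_neg (i : Fin (m + 1)) (φ : PowerSeries k) : onLetter i (-φ) = -onLetter i φ := by
  ext E
  rw [map_neg, coeff_onLetter, coeff_onLetter, map_neg]
  split_ifs <;> simp

/-- Substituting a family `Λ` into `φ(x_i)` gives `φ(Λ_i)`. -/
theorem subst_onLetter {n : ℕ} (Λ : Fin (m + 1) → MvPowerSeries (Fin n) k) (hΛ : HasSubst Λ) (i : Fin (m + 1))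
    (φ : PowerSeries k) : subst Λ (onLetter i φ) = PowerSeries.subst (Λ i) φ := by
  rw [onLetter, PowerSeries.subst_def, PowerSeries.subst_def, subst_comp_subst_apply
    (hasSubst_of_constantCoeff_zero fun _ => constantCoeff_X i) hΛ]
  simp_rw [subst_X hΛ]

/-! ## The graph shear -/

/-- The GRAPH SHEAR of the curve `C = {x_j = φ_j(x_i) : j ≠ i}`: `x_i ↦ x_i`, `x_j ↦ x_j + φ_j(x_i)`.  (The component `φ_i` is never read.) [OURS] -/
def shear (i : Fin (m + 1)) (φ : Fin (m + 1) → PowerSeries k) : Fin (m + 1) → MvPowerSeries (Fin (m + 1)) k :=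
  fun j => if j = i then X i else X j + onLetter i (φ j)

/-- The shear fixes the graph letter. -/
theorem shear_self (i : Fin (m + 1)) (φ : Fin (m + 1) → PowerSeries k) : shear i φ i = X i := if_pos rfl

/-- The shear on the other letters. -/
theorem shear_of_ne {i j : Fin (m + 1)} (h : j ≠ i) (φ : Fin (m + 1) → PowerSeries k) : shear i φ j = X j + onLetter i (φ j) :=
  if_neg h

/-- The shear has zero constant terms when `φ_j(0) = 0` for all `j ≠ i`. -/
theorem constantCoeff_shear {i : Fin (m + 1)} {φ : Fin (m + 1) → PowerSeries k}
    (hφ : ∀ j, j ≠ i → PowerSeries.constantCoeff (φ j) = 0) (j : Fin (m + 1)) : constantCoeff (shear i φ j) = 0 := by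
  by_cases h : j = i
  · rw [h, shear_self, constantCoeff_X]
  · rw [shear_of_ne h, map_add, constantCoeff_X, constantCoeff_onLetter, hφ j h, add_zero]

/-- The shear may be substituted. -/
theorem hasSubst_shear {i : Fin (m + 1)} {φ : Fin (m + 1) → PowerSeries k}
    (hφ : ∀ j, j ≠ i → PowerSeries.constantCoeff (φ j) = 0) : HasSubst (shear i φ) :=
  hasSubst_of_constantCoeff_zero (constantCoeff_shear hφ)

/-- The shear fixes every series in the graph letter. -/
theorem subst_shear_onLetter {i : Fin (m + 1)} {φ : Fin (m + 1) → PowerSeries k}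
    (hφ : ∀ j, j ≠ i → PowerSeries.constantCoeff (φ j) = 0) (ψ : PowerSeries k) :
    subst (shear i φ) (onLetter i ψ) = onLetter i ψ := by
  rw [subst_onLetter _ (hasSubst_shear hφ), shear_self, onLetter]

/-- THE INVERSE SHEAR: shearing by `φ` after shearing by `−φ` is the identity. -/
theorem subst_shear_shear_neg {i : Fin (m + 1)} {φ : Fin (m + 1) → PowerSeries k}
    (hφ : ∀ j, j ≠ i → PowerSeries.constantCoeff (φ j) = 0) (j : Fin (m + 1)) :
    subst (shear i φ) (shear i (-φ) j) = X j := by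
  have hs := hasSubst_shear hφ
  by_cases h : j = i
  · rw [h, shear_self, subst_X hs, shear_self]
  · rw [shear_of_ne h, ← coe_substAlgHom hs, map_add, coe_substAlgHom, subst_X hs, shear_of_ne h, subst_shear_onLetter hφ,
      Pi.neg_apply, onLetter_neg]
    ring

/-- THE GRAPH SHEAR IS A LEGAL COORDINATE CHANGE: invertible linear part. -/
theorem isUnit_det_linMat_shear {i : Fin (m + 1)} {φ : Fin (m + 1) → PowerSeries k}
    (hφ : ∀ j, j ≠ i → PowerSeries.constantCoeff (φ j) = 0) :
    IsUnit (Matrix.det (Matrix.of fun a j : Fin (m + 1) => coeff (Finsupp.single j 1) (shear i φ a))) := by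
  have hφ' : ∀ j, j ≠ i → PowerSeries.constantCoeff ((-φ) j) = 0 := fun j hj => by
    rw [Pi.neg_apply, map_neg, hφ j hj, neg_zero]
  exact TOT2E1.isUnit_det_linMat_of_comp_eq_X (constantCoeff_shear hφ) (subst_shear_shear_neg (φ := φ) hφ)

/-- The graph shear with weights `w ∈ {0,1}^{m+1} ∖ 0` is a move of the count game. -/
theorem isCountMove_shear {i : Fin (m + 1)} {φ : Fin (m + 1) → PowerSeries k}
    (hφ : ∀ j, j ≠ i → PowerSeries.constantCoeff (φ j) = 0) {w : Fin (m + 1) → ℕ} (hw : ∀ j, w j ≤ 1) (hpos : ∃ j, 0 < w j) :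
    IsCountMove (shear i φ) w :=
  ⟨constantCoeff_shear hφ, isUnit_det_linMat_shear hφ, hw, hpos⟩

/-- The graph shear is letter-preserving on every letter `l ≠ i` with `φ_l = 0`, and on `i`. -/
theorem shear_eq_X_of_eq_zero {i : Fin (m + 1)} {φ : Fin (m + 1) → PowerSeries k} {l : Fin (m + 1)} (h : l = i ∨ φ l = 0) :
    shear i φ l = X l := by
  by_cases hl : l = i
  · rw [hl, shear_self]
  · rw [shear_of_ne hl, h.resolve_left hl, onLetter_zero, add_zero]

/-! ## The tangent direction -/

/-- The TANGENT DIRECTION of the graph curve: `1` at the graph letter, `φ_j′(0)` at `j ≠ i`. [OURS] -/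
def tangent (i : Fin (m + 1)) (φ : Fin (m + 1) → PowerSeries k) : Fin (m + 1) → k :=
  fun j => if j = i then 1 else PowerSeries.coeff 1 (φ j)

/-- The tangent at the graph letter. -/
theorem tangent_self (i : Fin (m + 1)) (φ : Fin (m + 1) → PowerSeries k) : tangent i φ i = 1 := if_pos rfl

/-- The tangent at the other letters. -/
theorem tangent_of_ne {i j : Fin (m + 1)} (h : j ≠ i) (φ : Fin (m + 1) → PowerSeries k) : tangent i φ j = PowerSeries.coeff 1 (φ j) :=
  if_neg h

/-- The tangent is non-zero. -/
theorem tangent_ne_zero (i : Fin (m + 1)) (φ : Fin (m + 1) → PowerSeries k) : tangent i φ ≠ 0 := fun h => by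
  have h1 := congrFun h i
  rw [tangent_self, Pi.zero_apply] at h1
  exact one_ne_zero h1

/-- The linear part of the shear: the `i`-th column is the tangent. -/
theorem coeff_single_shear (i : Fin (m + 1)) (φ : Fin (m + 1) → PowerSeries k) (a : Fin (m + 1)) :
    coeff (Finsupp.single i 1) (shear i φ a) = tangent i φ a := by
  by_cases h : a = i
  · rw [h, shear_self, tangent_self, coeff_X, if_pos rfl]
  · rw [shear_of_ne h, tangent_of_ne h, map_add, coeff_X, if_neg (fun h' => h (Finsupp.single_left_injective one_ne_zero h').symm),
      zero_add, coeff_onLetter, Finsupp.single_eq_same, if_pos rfl]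

/-- THE TANGENT IS THE IMAGE OF `e_i` UNDER THE LINEAR PART of the shear. -/
theorem linMat_shear_mulVec_single (i : Fin (m + 1)) (φ : Fin (m + 1) → PowerSeries k) :
    (Matrix.of fun a j : Fin (m + 1) => coeff (Finsupp.single j 1) (shear i φ a)).mulVec (Pi.single i 1) = tangent i φ := by
  funext a
  rw [Matrix.mulVec_single_one]
  exact coeff_single_shear i φ a

/-! ## Off-letter degree and the permissibility ideal -/

/-- The degree of an exponent OFF the letter `i`. [OURS] -/
def offDeg (i : Fin (m + 1)) (E : Fin (m + 1) →₀ ℕ) : ℕ := ∑ j ∈ Finset.univ.erase i, E j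

/-- Off-degree plus the `i`-exponent is the total degree. -/
theorem offDeg_add_apply (i : Fin (m + 1)) (E : Fin (m + 1) →₀ ℕ) : offDeg i E + E i = E.degree := by
  rw [offDeg, Finsupp.degree_eq_sum, Finset.sum_erase_add _ _ (Finset.mem_univ i)]

/-- Off-degree is additive. -/
theorem offDeg_add (i : Fin (m + 1)) (E F : Fin (m + 1) →₀ ℕ) : offDeg i (E + F) = offDeg i E + offDeg i F := by
  simp only [offDeg, Finsupp.coe_add, Pi.add_apply, Finset.sum_add_distrib]

/-- Off-degree of zero. -/
theorem offDeg_zero (i : Fin (m + 1)) : offDeg i (0 : Fin (m + 1) →₀ ℕ) = 0 := by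
  simp [offDeg]

/-- Off-degree of a pure power of the graph letter is `0`. -/
theorem offDeg_single_self (i : Fin (m + 1)) (n : ℕ) : offDeg i (Finsupp.single i n) = 0 := by
  rw [offDeg]
  exact Finset.sum_eq_zero fun j hj => by rw [Finsupp.single_apply, if_neg (Finset.ne_of_mem_erase hj).symm]

/-- Off-degree of a power of another letter is its exponent. -/
theorem offDeg_single_of_ne {i j : Fin (m + 1)} (h : j ≠ i) (n : ℕ) : offDeg i (Finsupp.single j n) = n := by
  rw [offDeg, Finset.sum_eq_single_of_mem j (Finset.mem_erase.mpr ⟨h, Finset.mem_univ j⟩)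
    (fun l _ hl => by rw [Finsupp.single_apply, if_neg (Ne.symm hl)]), Finsupp.single_eq_same]

/-- An exponent with off-degree `0` is a pure power of the graph letter. -/
theorem eq_single_of_offDeg_eq_zero {i : Fin (m + 1)} {E : Fin (m + 1) →₀ ℕ} (h : offDeg i E = 0) : E = Finsupp.single i (E i) := by
  ext j
  by_cases hj : j = i
  · rw [hj, Finsupp.single_eq_same]
  · rw [Finsupp.single_apply, if_neg (Ne.symm hj)]
    rw [offDeg] at h
    exact (Finset.sum_eq_zero_iff.mp h) j (Finset.mem_erase.mpr ⟨hj, Finset.mem_univ j⟩)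

/-- The weight of an exponent for the weights `𝟙_{j ≠ i}` is its off-degree. -/
theorem weight_indicator_ne_eq_offDeg (i : Fin (m + 1)) (E : Fin (m + 1) →₀ ℕ) :
    Finsupp.weight (fun j : Fin (m + 1) => if j = i then 0 else 1) E = offDeg i E := by
  rw [Finsupp.weight_apply, Finsupp.sum_fintype _ _ (fun _ => by simp), offDeg, ← Finset.sum_erase_add _ _ (Finset.mem_univ i)]
  have hi : (E i • if i = i then (0 : ℕ) else 1) = 0 := by simp
  rw [hi, add_zero]
  exact Finset.sum_congr rfl fun j hj => by simp [Finset.ne_of_mem_erase hj]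

/-- `InOffIdeal i c G`: every monomial of `G` has off-`i` degree `≥ c` — `G ∈ (x_j : j ≠ i)^c`, i.e. THE `i`-AXIS IS PERMISSIBLE FOR `G` AT
ORDER `c` (for `i = Fin.last m` this is `AxisPolyhedron.InAxisIdeal c G`). [OURS] -/
def InOffIdeal (i : Fin (m + 1)) (c : ℕ) (G : MvPowerSeries (Fin (m + 1)) k) : Prop :=
  ∀ E : Fin (m + 1) →₀ ℕ, coeff E G ≠ 0 → c ≤ offDeg i E

/-- For the last letter, `InOffIdeal` is the weighted engine's `InAxisIdeal`. -/
theorem inOffIdeal_last_iff_inAxisIdeal (c : ℕ) (G : MvPowerSeries (Fin (m + 1)) k) :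
    InOffIdeal (Fin.last m) c G ↔ AxisPolyhedron.InAxisIdeal c G := by
  have hx : ∀ E : Fin (m + 1) →₀ ℕ, AxisPolyhedron.xDeg E = offDeg (Fin.last m) E := fun E => by
    rw [← weight_indicator_ne_eq_offDeg, weight_indicator_castSucc_eq_xDeg]
  constructor
  · intro h E hlt
    by_contra hne
    exact absurd (h E hne) (by rw [← hx]; exact not_le.mpr hlt)
  · intro h E hne
    by_contra hlt
    exact hne (h E (by rw [hx]; exact not_le.mp hlt))

/-- `InOffIdeal` gives the `𝟙_{j ≠ i}`-weighted order bound `c`. -/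
theorem le_weightedOrder_of_inOffIdeal {i : Fin (m + 1)} {c : ℕ} {G : MvPowerSeries (Fin (m + 1)) k} (h : InOffIdeal i c G) :
    (c : ℕ∞) ≤ G.weightedOrder (fun j : Fin (m + 1) => if j = i then 0 else 1) := by
  refine le_weightedOrder _ fun E hE => ?_
  by_contra hne
  rw [weight_indicator_ne_eq_offDeg, Nat.cast_lt] at hE
  exact absurd (h E hne) (not_le.mpr hE)

/-! ## Division by the variable and the step series -/

/-- `φ / X` (drop the constant coefficient and shift). [OURS] -/
def tailDiv (φ : PowerSeries k) : PowerSeries k := PowerSeries.mk fun n => PowerSeries.coeff (n + 1) φ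

/-- Coefficients of `φ / X`. -/
theorem coeff_tailDiv (φ : PowerSeries k) (n : ℕ) : PowerSeries.coeff n (tailDiv φ) = PowerSeries.coeff (n + 1) φ :=
  PowerSeries.coeff_mk _ _

/-- `X · (φ / X) = φ` when `φ(0) = 0`. -/
theorem X_mul_tailDiv {φ : PowerSeries k} (h : PowerSeries.constantCoeff φ = 0) : PowerSeries.X * tailDiv φ = φ := by
  ext n
  cases n with
  | zero => rw [PowerSeries.coeff_zero_X_mul, PowerSeries.coeff_zero_eq_constantCoeff, h]
  | succ n => rw [PowerSeries.coeff_succ_X_mul, coeff_tailDiv]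

/-- `0 / X = 0`. -/
theorem tailDiv_zero : tailDiv (0 : PowerSeries k) = 0 := by
  ext n; rw [coeff_tailDiv, map_zero, map_zero]

/-- The order of `φ / X` is one less than the order of `φ` (`φ(0) = 0`, `φ ≠ 0`). -/
theorem order_tailDiv_add_one {φ : PowerSeries k} (h0 : PowerSeries.constantCoeff φ = 0) (hφ : φ ≠ 0) :
    (tailDiv φ).order + 1 = φ.order := by
  have hX : φ = PowerSeries.X * tailDiv φ := (X_mul_tailDiv h0).symm
  have ht : tailDiv φ ≠ 0 := fun h => hφ (by rw [hX, h, mul_zero])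
  conv_rhs => rw [hX, mul_comm, PowerSeries.order_mul, PowerSeries.order_X]

/-- THE STEP SERIES `(φ(λ s) − a s)/s`: the graph component of the strict transform of the curve under the identity point move at the answer
`c′ = λ · tangent` (`a = c′_j = λ φ_j′(0)`), as a series in the exceptional letter `s`. [OURS] -/
def stepSeries (φ : PowerSeries k) (lam a : k) : PowerSeries k :=
  tailDiv (PowerSeries.rescale lam φ) - PowerSeries.C a

/-- Coefficients of the step series. -/
theorem coeff_stepSeries (φ : PowerSeries k) (lam a : k) (n : ℕ) :
    PowerSeries.coeff n (stepSeries φ lam a) = lam ^ (n + 1) * PowerSeries.coeff (n + 1) φ - if n = 0 then a else 0 := by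
  rw [stepSeries, map_sub, coeff_tailDiv, PowerSeries.coeff_rescale, PowerSeries.coeff_C]

/-- The step series of the zero component (with `a = 0`) is zero. -/
theorem stepSeries_zero (lam : k) : stepSeries (0 : PowerSeries k) lam 0 = 0 := by
  ext n; rw [coeff_stepSeries, map_zero, mul_zero, map_zero]; split_ifs <;> simp

/-- The step series has zero constant term when `a = λ · φ′(0)`. -/
theorem constantCoeff_stepSeries {φ : PowerSeries k} {lam a : k} (ha : a = lam * PowerSeries.coeff 1 φ) :
    PowerSeries.constantCoeff (stepSeries φ lam a) = 0 := by
  rw [← PowerSeries.coeff_zero_eq_constantCoeff, coeff_stepSeries, if_pos rfl, zero_add, pow_one, ha, sub_self]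

/-- `s · stepSeries = φ(λ s) − a s` when `φ(0) = 0`. -/
theorem X_mul_stepSeries {φ : PowerSeries k} (h0 : PowerSeries.constantCoeff φ = 0) (lam a : k) :
    PowerSeries.X * stepSeries φ lam a = PowerSeries.rescale lam φ - PowerSeries.C a * PowerSeries.X := by
  rw [stepSeries, mul_sub, X_mul_tailDiv (by rw [← PowerSeries.coeff_zero_eq_constantCoeff, PowerSeries.coeff_rescale, pow_zero, one_mul,
    PowerSeries.coeff_zero_eq_constantCoeff, h0]), mul_comm]

/-- THE CONTACT ORDER DROPS BY EXACTLY ONE: for `φ ≠ 0` with `φ(0) = 0` and `φ′(0) = 0` (a letter plane tangent to the curve, `a = 0`) and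
`λ ≠ 0`, `ord (stepSeries φ λ 0) + 1 = ord φ`. -/
theorem order_stepSeries_add_one {φ : PowerSeries k} (h0 : PowerSeries.constantCoeff φ = 0) (hφ : φ ≠ 0) {lam : k} (hlam : lam ≠ 0) :
    (stepSeries φ lam 0).order + 1 = φ.order := by
  have hr0 : PowerSeries.constantCoeff (PowerSeries.rescale lam φ) = 0 := by
    rw [← PowerSeries.coeff_zero_eq_constantCoeff, PowerSeries.coeff_rescale, pow_zero, one_mul, PowerSeries.coeff_zero_eq_constantCoeff, h0]
  have hr : PowerSeries.rescale lam φ ≠ 0 := fun h => hφ (by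
    have := congrArg (PowerSeries.rescale lam⁻¹) h
    rwa [PowerSeries.rescale_rescale, mul_inv_cancel₀ hlam, PowerSeries.rescale_one, RingHom.id_apply, map_zero] at this)
  have hord : (PowerSeries.rescale lam φ).order = φ.order := by
    refine le_antisymm ?_ ?_
    · have hn : ((φ.order.toNat : ℕ) : ℕ∞) = φ.order := ENat.coe_toNat (by rw [ne_eq, PowerSeries.order_eq_top]; exact hφ)
      rw [← hn]
      exact PowerSeries.order_le _ (by
        rw [PowerSeries.coeff_rescale]; exact mul_ne_zero (pow_ne_zero _ hlam) (PowerSeries.coeff_order hφ))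
    · exact PowerSeries.le_order _ _ fun j hj => by
        rw [PowerSeries.coeff_rescale, PowerSeries.coeff_of_lt_order j hj, mul_zero]
  rw [stepSeries, map_zero, sub_zero, order_tailDiv_add_one hr0 hr, hord]

/-! ## The step of the graph datum and the contact potential -/

/-- THE GRAPH DATUM OF THE STRICT TRANSFORM at the tangent answer `c′` (`c′ = c′_i · tangent`), a graph over the NEW exceptional letter `0` of the
successor's letters `(s, y_j)` (`y_j` at index `Fin.predAbove i (succ j) = (p : Fin m).succ` for `j = i.succAbove p`):
`φ′_0 = 0`, `φ′_{p.succ} = (φ_j(c′_i s) − c′_j s)/s`. [OURS] -/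
def step (i : Fin (m + 1)) (φ : Fin (m + 1) → PowerSeries k) (c' : Fin (m + 1) → k) : Fin (m + 1) → PowerSeries k :=
  Fin.cases 0 fun p => stepSeries (φ (i.succAbove p)) (c' i) (c' (i.succAbove p))

/-- The step datum at the new graph letter. -/
theorem step_zero (i : Fin (m + 1)) (φ : Fin (m + 1) → PowerSeries k) (c' : Fin (m + 1) → k) : step i φ c' 0 = 0 :=
  Fin.cases_zero

/-- The step datum at the other new letters. -/
theorem step_succ (i : Fin (m + 1)) (φ : Fin (m + 1) → PowerSeries k) (c' : Fin (m + 1) → k) (p : Fin m) :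
    step i φ c' p.succ = stepSeries (φ (i.succAbove p)) (c' i) (c' (i.succAbove p)) :=
  Fin.cases_succ _

/-- THE CONTACT POTENTIAL: the sum over the letters `l ∈ E ∖ {i}` of the squared contact order of the curve with the letter plane `x_l = 0`
(`(ord φ_l)²`; a letter containing the curve, `φ_l = 0`, contributes `0`). [OURS] -/
def contactSq (E : Finset (Fin (m + 1))) (i : Fin (m + 1)) (φ : Fin (m + 1) → PowerSeries k) : ℕ :=
  ∑ l ∈ E.erase i, ((φ l).order.toNat) ^ 2

/-- The contact potential vanishes iff every letter other than the graph letter contains the curve. -/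
theorem contactSq_eq_zero_iff (E : Finset (Fin (m + 1))) (i : Fin (m + 1)) (φ : Fin (m + 1) → PowerSeries k)
    (h0 : ∀ j, j ≠ i → PowerSeries.constantCoeff (φ j) = 0) :
    contactSq E i φ = 0 ↔ ∀ l ∈ E, l ≠ i → φ l = 0 := by
  rw [contactSq, Finset.sum_eq_zero_iff]
  constructor
  · intro h l hl hli
    have h1 := h l (Finset.mem_erase.mpr ⟨hli, hl⟩)
    rw [pow_eq_zero_iff two_ne_zero, ENat.toNat_eq_zero] at h1
    rcases h1 with h1 | h1
    · -- order `0` contradicts `φ_l(0) = 0` unless `φ_l = 0`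
      by_contra hne
      have := PowerSeries.order_eq_nat.mp h1
      exact this.1 (by rw [PowerSeries.coeff_zero_eq_constantCoeff, h0 l hli])
    · exact PowerSeries.order_eq_top.mp h1
  · intro h l hl
    obtain ⟨hli, hlE⟩ := Finset.mem_erase.mp hl
    rw [h l hlE hli, PowerSeries.order_zero, ENat.toNat_top, zero_pow two_ne_zero]

end GraphCurve

end TameFourTupleDrop

end Summit.ResolutionOfSingularities.ResolutionOfSingularities.Theorems

end
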